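import Summits.QuantumFields.BalabanUV.Beta.RemainderExplicitHistoryDiagonalWindowEverywhere

/-!
# RemainderExplicitHistoryDiagonalRateEverywhere — ROAD P3, ORDER-0 PROFILE FAMILY: THE MAJORANT INDUCTION OVER THE WHOLE RUN — on the
# every-position window law of the first file the induction `d_{j₀} ≤ Λ·√(K−j₀)·τ(j₀+1)` runs from the ultraviolet END: the shape hypothesis
# (T1) `Σρ(a)min(a,K)² ≤ A₁K²τ(K)` DISAPPEARS (only the convolution shape (T2) remains), `Λ = 4C_w∕√b` carries no `κA₁`, and the pair condition
# `K ≤ 2j₀ + 1` — in family form `m ≤ n + 1` — is GONE: `astar g m − invSq g m n ≤ Λ√m·τ(n+1)` for ALL `m` above the threshold and ALL cutoffs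
# `n` (second file of station S-d4p3-g51-1 «the tails alone buy the rate»; the third file instantiates every power tail `q > 1`, `q ≥ 2` included)

Cell `pub-balaban`, β-function sub-cell, BINDER row D4 «RemainderConst leaves for Bałaban's split» (`HOME/BINDER-OWNERS.md`; owner
lineage `b2b-balaban-beta-an4`; this file by co-owner #3 lineage `b2b-balaban-beta-d4-p3`, road P3 «the reduction road», generation 51,
station S-d4p3-g51-1, second file; imports the station's first file `RemainderExplicitHistoryDiagonalWindowEverywhere`), β-FLOW TEAM duty
(1); FREEZE (0) honoured (def-free module in road P3's own `RemainderExplicit*` series; no leaf, no interface, no Literature file).  SOURCE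
OF THE SHAPES ONLY: [Balaban1987RG1] (0.20) p. 256, (0.31) and Thm 2 p. 259, §5 p. 298.  Pure real analysis about ONE explicit toy family
(ours, not Bałaban's).

HONEST FRAMING (page 1 of everything the β sub-cell writes).  *"Discharging BetaPertH makes Bałaban's UV stability UNCONDITIONAL — a real
constructive-QFT result; it is NOT the continuum limit and NOT the Clay problem."*  THIS FILE DISCHARGES NOTHING OF THE KIND.  Generation
49's `…Rate.disc_le_majorant` proved the majorant shape `Λ√(K−j₀)·τ(j₀+1)` at the positions of the INFRARED HALF, handling the ultraviolet
half by generation 48's global sandwich and the shape hypothesis (T1) — which fails for power tails `q ≥ 2` (generation 50's census OPEN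
(ii′): «a two-variable majorant is needed»).  THIS FILE shows that NO second variable is needed: the ONE-variable shape `√(K−i)·τ(i+1)` IS a
valid majorant over the ultraviolet half as well — what failed was only its derivation from the global maximum.  With the first file's
window law at every position (constant `C_w`) the induction step at an ultraviolet position is IDENTICAL to the infrared one: the window
source is `≤ 2√σ·τ(j₀+1)∕√b` at any position (`…Rate.tailWindow_le`), an ultraviolet position `i < j₀` feeds back `((g^A_i)³∕2)·d_i·τ(j₀−i) ≤
(Λ∕(2b√b))·τ(i+1)τ(j₀−i)∕(j₀+1−i)` by the induction hypothesis, (T2) sums this to `≤ ΛA₂τ(j₀+1)∕(2b√b)`, and the threshold `C_wA₂ ≤ b√b·√(K−j₀)`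
at the target position holds at every ultraviolet position feeding it (larger infrared distance) — no case split (§1).  SEAT NUMERICS
(`HOME/b2b-balaban-beta-d4-p3/g51/numerics/rate_q2plus.out`, pure python): for `ρ(a) = 0.3∕(a+1)^p`, `p ∈ {3,4,5,6}` (`g_IR = 0.5`, `b = 1`)
the ratio `(astar g m − invSq g m n)∕(√m·Σ_{a>n}ρ(a))` stays in `[0.10, 0.69]` for `m ≤ 8 ≤ n ≤ 128` and is `< 0.2` beyond the half
(`m > n + 1`): the rate `√m·τ(n+1)` persists for every `q ≥ 2`.  Nothing of Bałaban's (1.22) is asserted or constructed; row D4 class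
UNCHANGED (critical-path width 0; instance 0∕1; D4 DISCHARGE NO DATE); NOT B12 Thm 2, NOT BetaPertH, NOT continuum, NOT Clay.  HONEST
DEPENDENCY: continuum YM on T⁴ ⇐ BetaPertH ∧ nine spine estimates (0/9 proved); BetaPertH ⇐ (D1) ∧ (D4) ∧ CAP+tail; G-an2-4 gates asym, D1
and NE2/3/4.  ABSOLUTE RULE: nothing is cited as a fact.

WHAT IS PROVED ([folklore]; 0 sorry; 0 `def`; the family as the hypothesis `hβ` on an abstract `β : FlowStep.HBeta`, `ρ ≥ 0`, `b > 0`; a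
tail majorant `τ ≥ 0`, non-increasing, `R(N) − R(k) ≤ τ(k)`, with (T2) `Σ_{i<j₀} τ(i+1)τ(j₀−i)∕(j₀+1−i) ≤ A₂τ(j₀+1)`; NO (T1)).
* §1 **`disc_le_majorant_of_windowLaw`** (two pinned runs A: `K` steps, B: `K + n` steps in ]0,γ], and a window-law constant `C_w ≥ 0` for the
  pair: `∀ j₀ ≤ K, d_{j₀} ≤ C_w·((1∕√b)𝒯_{j₀} + Σ_{i<j₀}((g^A_i)³∕2)d_i(R(K−i) − R(j₀−i)))` ⇒ for EVERY `j₀ ≤ K` with `C_wA₂ ≤ b√b·√(K−j₀)`: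
  `d_{j₀} ≤ (4C_w∕√b)·√(K−j₀)·τ(j₀+1)`).
* §2 **`disc_le_majorant_everywhere`** (`2Wγ < b`: `C_w = (1−Wγ∕b)∕(1−2Wγ∕b)`), **`disc_le_majorant_everywhere_tail`** (`Wγ < b`, `Σ_{i<N}τ(i+1) ≤ Ts`,
  `2√2Ts ≤ (1−Wγ∕b)b√b·K√K`: `C_w = 2`, `Λ = 8∕√b`).
* §3 (a pinned family `K ↦ g K`) `invSq_sub_le_rate_everywhere`, **`astar_sub_invSq_le_rate_everywhere`** (`2Wγ < b`; `C_wA₂ ≤ b√b√m` ⇒ for ALL `n`: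
  `0 ≤ astar g m − invSq g m n ≤ (4C_w∕√b)√m·τ(n+1)`), `invSq_sub_le_rate_everywhere_tail`, **`astar_sub_invSq_le_rate_everywhere_tail`** (`Wγ < b`;
  `2A₂ ≤ b√b√m`, `2√2Ts ≤ (1−Wγ∕b)b√b·m√m` ⇒ for ALL `n`: `… ≤ (8∕√b)√m·τ(n+1)`).
* §4 **`astar_sub_invSq_le_rate_everywhere_uniform`** ∕ **`…_uniform_tail`** (below the threshold: `m ≤ σ₀ ≤ n + m` ⇒
  `astar g m − invSq g m n ≤ Λ√σ₀·τ(n+m+1−σ₀)∕(1 − Wγ∕b)`).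
All letters NOT-IN-PRINT; `BetaFlowAsPrinted S` records a Markov β_n only ⇒ no junction of the as-printed interface changes.
-/

noncomputable section

open Finset Filter Topology

namespace Summit.QuantumFields.BalabanUV.Beta.RemainderExplicitHistoryDiagonalRateEverywhere

open Literature.MathematicalPhysics.QuantumFieldTheory.Balaban1983to89
open Literature.MathematicalPhysics.QuantumFieldTheory.Balaban1983to89.FlowStep
open Literature.MathematicalPhysics.QuantumFieldTheory.Balaban1983to89.T4CouplingMatching
open Literature.MathematicalPhysics.QuantumFieldTheory.Balaban1983to89.T4ContinuumCoupling
open Summit.QuantumFields.BalabanUV.Beta.RemainderExplicitHistoryDiagonalMonotone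
open Summit.QuantumFields.BalabanUV.Beta.RemainderExplicitHistoryDiagonalWeights
open Summit.QuantumFields.BalabanUV.Beta.RemainderExplicitHistoryDiagonalTwoRun
open Summit.QuantumFields.BalabanUV.Beta.RemainderExplicitHistoryDiagonalWindow
open Summit.QuantumFields.BalabanUV.Beta.RemainderExplicitHistoryDiagonalComparison
open Summit.QuantumFields.BalabanUV.Beta.RemainderExplicitHistoryDiagonalRate
open Summit.QuantumFields.BalabanUV.Beta.RemainderExplicitHistoryDiagonalWindowEverywhere

variable {β : HBeta} {b γ W A₂ Cw : ℝ} {ρ τ : ℕ → ℝ}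

/-! ## §1 The majorant induction from the ultraviolet end, on a window law at every position -/

/-- **THE MAJORANT INDUCTION OVER THE WHOLE RUN.**  Two runs of the order-0 profile family in ]0,γ] (`b > 0`, `γ > 0`, `ρ ≥ 0`) — A: `K` steps,
B: `K + n` steps — pinned `g^A_K = g^B_{K+n}`; a tail majorant `τ ≥ 0`, non-increasing, `R(N) − R(k) ≤ τ(k)` (`k ≤ N`), with the convolution shape
(T2) `Σ_{i<j₀} τ(i+1)τ(j₀−i)∕(j₀+1−i) ≤ A₂τ(j₀+1)`; and a WINDOW-LAW CONSTANT `C_w ≥ 0` for the pair: at every position `j₀ ≤ K`,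
`d_{j₀} ≤ C_w·((1∕√b)·𝒯_{j₀} + Σ_{i<j₀} ((g^A_i)³∕2)·d_i·(R(K−i) − R(j₀−i)))`.  THEN at EVERY position `j₀ ≤ K` whose infrared distance `σ = K − j₀` has
`C_w·A₂ ≤ b√b·√σ`:  `1∕(g^B_{j₀+n})² − 1∕(g^A_{j₀})² ≤ (4C_w∕√b)·√σ·τ(j₀+1)`.  Strong induction on `j₀` from the ultraviolet end with NO case
split: the window source is `≤ C_w·2√σ·τ(j₀+1)∕√b` (`…Rate.tailWindow_le`), an ultraviolet position `i < j₀` (infrared distance `> σ`, so the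
threshold holds there too) contributes `((g^A_i)³∕2)·d_i·τ(j₀−i) ≤ (Λ∕(2b√b))·τ(i+1)τ(j₀−i)∕(j₀+1−i)` by `…Rate.cube_half_le` and the induction
hypothesis, and (T2) closes: `C_w·ΛA₂τ(j₀+1)∕(2b√b) ≤ (Λ∕2)√σ·τ(j₀+1)`.  No (T1), no `K ≤ 2j₀+1`. [cite: Balaban1987RG1, (0.20) p.256, (0.31) and Thm 2 p.259] -/
theorem disc_le_majorant_of_windowLaw
    (hβ : ∀ (k : ℕ) (p : Fin (k + 1) → ℝ),
      β k p = b + ∑ i : Fin (k + 1), ρ (k - i) * min (p (Fin.last k)) (|p (Fin.last k) - p i|))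
    (hb : 0 < b) (hγ : 0 < γ) (hρ0 : ∀ a, 0 ≤ ρ a)
    (hτ0 : ∀ k, 0 ≤ τ k) (hτmono : ∀ k l, k ≤ l → τ l ≤ τ k)
    (hτ : ∀ k N, k ≤ N → ∑ a ∈ range N, ρ a - ∑ a ∈ range k, ρ a ≤ τ k)
    (hT2 : ∀ j₀ : ℕ, ∑ i ∈ range j₀, τ (i + 1) * τ (j₀ - i) / ((j₀ + 1 - i : ℕ) : ℝ) ≤ A₂ * τ (j₀ + 1)) (hCw : 0 ≤ Cw)
    {K n : ℕ} {gA gB : ℕ → ℝ} (hA : RGEqH K β gA) (hB : RGEqH (K + n) β gB)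
    (hAbox : ∀ k, k ≤ K → 0 < gA k ∧ gA k ≤ γ) (hBbox : ∀ k, k ≤ K + n → 0 < gB k ∧ gB k ≤ γ) (hpin : gA K = gB (K + n))
    (hwl : ∀ j₀, j₀ ≤ K → 1 / (gB (j₀ + n)) ^ 2 - 1 / (gA j₀) ^ 2
      ≤ Cw * (1 / Real.sqrt b * (∑ j ∈ Ico j₀ K, (∑ a ∈ range (j + n + 1), ρ a - ∑ a ∈ range (j + 1), ρ a)
            / Real.sqrt ((K - j : ℕ) : ℝ))
          + ∑ i ∈ range j₀, (gA i) ^ 3 / 2 * (1 / (gB (i + n)) ^ 2 - 1 / (gA i) ^ 2)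
              * (∑ a ∈ range (K - i), ρ a - ∑ a ∈ range (j₀ - i), ρ a))) :
    ∀ j₀, j₀ ≤ K → Cw * A₂ ≤ b * Real.sqrt b * Real.sqrt ((K - j₀ : ℕ) : ℝ) →
      1 / (gB (j₀ + n)) ^ 2 - 1 / (gA j₀) ^ 2 ≤ 4 * Cw / Real.sqrt b * Real.sqrt ((K - j₀ : ℕ) : ℝ) * τ (j₀ + 1) := by
  have hApos : ∀ k, k ≤ K → 0 < gA k := fun k hk => (hAbox k hk).1
  have hBpos : ∀ k, k ≤ K + n → 0 < gB k := fun k hk => (hBbox k hk).1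
  have hlo : BetaLowerH b γ β :=
    RemainderExplicitHistoryHalfMomentWitness.lower (γ := γ) (lam := fun k i => ρ (k - i)) hβ (fun k i => hρ0 _)
  have hsb : 0 < Real.sqrt b := Real.sqrt_pos.2 hb
  have hbsb : 0 < b * Real.sqrt b := by positivity
  set Λ : ℝ := 4 * Cw / Real.sqrt b with hΛ
  have hΛ0 : 0 ≤ Λ := by positivity
  have hdom := invSq_le_invSq_shift_run hβ hb hρ0 hA hB hApos hBpos hpin
  set d : ℕ → ℝ := fun j => 1 / (gB (j + n)) ^ 2 - 1 / (gA j) ^ 2 with hd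
  have hdnn : ∀ j, j ≤ K → 0 ≤ d j := fun j hj => by have := hdom j hj; simp only [hd]; linarith
  intro j₀
  induction j₀ using Nat.strong_induction_on with
  | _ j₀ ih =>
    intro hj₀ hσ
    show d j₀ ≤ Λ * Real.sqrt ((K - j₀ : ℕ) : ℝ) * τ (j₀ + 1)
    rcases Nat.eq_or_lt_of_le hj₀ with hjK | hjK
    · -- at the pin
      have : d j₀ = 0 := by simp [hd, hjK, hpin]
      rw [this]; exact mul_nonneg (mul_nonneg hΛ0 (Real.sqrt_nonneg _)) (hτ0 _)
    have hs : (0 : ℝ) < ((K - j₀ : ℕ) : ℝ) := by exact_mod_cast (show 0 < K - j₀ by omega)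
    have hss : 0 < Real.sqrt ((K - j₀ : ℕ) : ℝ) := Real.sqrt_pos.2 hs
    -- the majorant at every ultraviolet position `i < j₀` (the threshold transfers: `K − i ≥ K − j₀`)
    have hM : ∀ i, i < j₀ → d i ≤ Λ * Real.sqrt ((K - i : ℕ) : ℝ) * τ (i + 1) := by
      intro i hi
      have hσi : Cw * A₂ ≤ b * Real.sqrt b * Real.sqrt ((K - i : ℕ) : ℝ) := by
        refine hσ.trans (mul_le_mul_of_nonneg_left (Real.sqrt_le_sqrt ?_) hbsb.le)
        exact_mod_cast (show K - j₀ ≤ K - i by omega)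
      exact ih i hi (by omega) hσi
    -- the window law at `j₀`
    have hup := hwl j₀ hj₀
    -- the window source
    have hT := tailWindow_le hτ0 hτmono hτ j₀ K n
    have h1 : Cw * (1 / Real.sqrt b * (∑ j ∈ Ico j₀ K, (∑ a ∈ range (j + n + 1), ρ a - ∑ a ∈ range (j + 1), ρ a)
        / Real.sqrt ((K - j : ℕ) : ℝ))) ≤ Λ / 2 * Real.sqrt ((K - j₀ : ℕ) : ℝ) * τ (j₀ + 1) := by
      calc Cw * (1 / Real.sqrt b * (∑ j ∈ Ico j₀ K, (∑ a ∈ range (j + n + 1), ρ a - ∑ a ∈ range (j + 1), ρ a)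
            / Real.sqrt ((K - j : ℕ) : ℝ))) ≤ Cw * (1 / Real.sqrt b * (2 * Real.sqrt ((K - j₀ : ℕ) : ℝ) * τ (j₀ + 1))) :=
            mul_le_mul_of_nonneg_left (mul_le_mul_of_nonneg_left hT (by positivity)) hCw
        _ = Λ / 2 * Real.sqrt ((K - j₀ : ℕ) : ℝ) * τ (j₀ + 1) := by rw [hΛ]; field_simp; ring
    -- the ultraviolet feedback, term by term
    have hterm : ∀ i ∈ range j₀, (gA i) ^ 3 / 2 * (1 / (gB (i + n)) ^ 2 - 1 / (gA i) ^ 2)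
        * (∑ a ∈ range (K - i), ρ a - ∑ a ∈ range (j₀ - i), ρ a)
        ≤ Λ / (2 * b * Real.sqrt b) * (τ (i + 1) * τ (j₀ - i) / ((j₀ + 1 - i : ℕ) : ℝ)) := by
      intro i hi
      have hi' := Finset.mem_range.mp hi
      have hsi : (0 : ℝ) < ((K - i : ℕ) : ℝ) := by exact_mod_cast (show 0 < K - i by omega)
      have hssi : 0 < Real.sqrt ((K - i : ℕ) : ℝ) := Real.sqrt_pos.2 hsi
      have hc := cube_half_le hγ hb hA hAbox hlo (show i < K by omega)
      have hdi := hM i hi'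
      have hR : ∑ a ∈ range (K - i), ρ a - ∑ a ∈ range (j₀ - i), ρ a ≤ τ (j₀ - i) := hτ (j₀ - i) (K - i) (by omega)
      have hR0 : 0 ≤ ∑ a ∈ range (K - i), ρ a - ∑ a ∈ range (j₀ - i), ρ a := by
        linarith [partialSum_mono hρ0 (show j₀ - i ≤ K - i by omega)]
      have hg0 : 0 ≤ (gA i) ^ 3 / 2 := by have := hApos i (by omega); positivity
      calc (gA i) ^ 3 / 2 * d i * (∑ a ∈ range (K - i), ρ a - ∑ a ∈ range (j₀ - i), ρ a)
          ≤ (1 / (2 * b * Real.sqrt b) * (1 / (((K - i : ℕ) : ℝ) * Real.sqrt ((K - i : ℕ) : ℝ))))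
              * (Λ * Real.sqrt ((K - i : ℕ) : ℝ) * τ (i + 1)) * τ (j₀ - i) :=
            mul_le_mul (mul_le_mul hc hdi (hdnn i (by omega)) (by positivity)) hR hR0
              (mul_nonneg (by positivity) (mul_nonneg (mul_nonneg hΛ0 (Real.sqrt_nonneg _)) (hτ0 _)))
        _ = Λ / (2 * b * Real.sqrt b) * (τ (i + 1) * τ (j₀ - i) / ((K - i : ℕ) : ℝ)) := by
            field_simp
        _ ≤ Λ / (2 * b * Real.sqrt b) * (τ (i + 1) * τ (j₀ - i) / ((j₀ + 1 - i : ℕ) : ℝ)) := by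
            refine mul_le_mul_of_nonneg_left ?_ (by positivity)
            refine div_le_div_of_nonneg_left (mul_nonneg (hτ0 _) (hτ0 _)) ?_ ?_
            · exact_mod_cast (show 0 < j₀ + 1 - i by omega)
            · exact_mod_cast (show j₀ + 1 - i ≤ K - i by omega)
    have h2 : Cw * ∑ i ∈ range j₀, (gA i) ^ 3 / 2 * (1 / (gB (i + n)) ^ 2 - 1 / (gA i) ^ 2)
        * (∑ a ∈ range (K - i), ρ a - ∑ a ∈ range (j₀ - i), ρ a) ≤ Λ / 2 * Real.sqrt ((K - j₀ : ℕ) : ℝ) * τ (j₀ + 1) := by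
      calc Cw * ∑ i ∈ range j₀, (gA i) ^ 3 / 2 * (1 / (gB (i + n)) ^ 2 - 1 / (gA i) ^ 2)
            * (∑ a ∈ range (K - i), ρ a - ∑ a ∈ range (j₀ - i), ρ a)
          ≤ Cw * ∑ i ∈ range j₀, Λ / (2 * b * Real.sqrt b) * (τ (i + 1) * τ (j₀ - i) / ((j₀ + 1 - i : ℕ) : ℝ)) :=
            mul_le_mul_of_nonneg_left (Finset.sum_le_sum hterm) hCw
        _ = Cw * (Λ / (2 * b * Real.sqrt b)) * ∑ i ∈ range j₀, τ (i + 1) * τ (j₀ - i) / ((j₀ + 1 - i : ℕ) : ℝ) := by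
            rw [← Finset.mul_sum, ← mul_assoc]
        _ ≤ Cw * (Λ / (2 * b * Real.sqrt b)) * (A₂ * τ (j₀ + 1)) := mul_le_mul_of_nonneg_left (hT2 j₀) (by positivity)
        _ = Λ / (2 * b * Real.sqrt b) * ((Cw * A₂) * τ (j₀ + 1)) := by ring
        _ ≤ Λ / (2 * b * Real.sqrt b) * ((b * Real.sqrt b * Real.sqrt ((K - j₀ : ℕ) : ℝ)) * τ (j₀ + 1)) :=
            mul_le_mul_of_nonneg_left (mul_le_mul_of_nonneg_right hσ (hτ0 _)) (by positivity)
        _ = Λ / 2 * Real.sqrt ((K - j₀ : ℕ) : ℝ) * τ (j₀ + 1) := by field_simp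
    have : d j₀ = 1 / (gB (j₀ + n)) ^ 2 - 1 / (gA j₀) ^ 2 := rfl
    rw [mul_add] at hup
    linarith [hup, h1, h2]

/-! ## §2 The two instantiations of the window-law constant -/

/-- **ROAD P3 — THE MAJORANT AT EVERY POSITION (box-type smallness `2Wγ < b`).**  Two runs of the order-0 profile family in ]0,γ] (`b > 0`,
`γ > 0`, `ρ ≥ 0`, `Σ_{a<N} ρ_a ≤ W`, `2Wγ < b`) — A: `K` steps, B: `K + n` steps — pinned `g^A_K = g^B_{K+n}`; a tail majorant `τ` of the profile, `≥ 0`,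
non-increasing, with (T2) (constant `A₂`).  With `C_w = (1 − Wγ∕b)∕(1 − 2Wγ∕b)`: at EVERY position `j₀ ≤ K` with `C_wA₂ ≤ b√b·√(K−j₀)`,
`1∕(g^B_{j₀+n})² − 1∕(g^A_{j₀})² ≤ (4C_w∕√b)·√(K−j₀)·τ(j₀+1)` — the first file's `window_law_upper_everywhere` fed into §1.  Compare generation 49's
`…Rate.disc_le_majorant`: there `K ≤ 2j₀ + 1`, (T1), and `Λ = 4∕√b + 8√2κA₁∕((1−Wγ∕b)√b)`. [cite: Balaban1987RG1, (0.20) p.256, (0.31) and Thm 2 p.259] -/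
theorem disc_le_majorant_everywhere
    (hβ : ∀ (k : ℕ) (p : Fin (k + 1) → ℝ),
      β k p = b + ∑ i : Fin (k + 1), ρ (k - i) * min (p (Fin.last k)) (|p (Fin.last k) - p i|))
    (hb : 0 < b) (hγ : 0 < γ) (hρ0 : ∀ a, 0 ≤ ρ a) (hρW : ∀ n, ∑ a ∈ range n, ρ a ≤ W) (hsmall2 : 2 * W * γ < b)
    (hτ0 : ∀ k, 0 ≤ τ k) (hτmono : ∀ k l, k ≤ l → τ l ≤ τ k)
    (hτ : ∀ k N, k ≤ N → ∑ a ∈ range N, ρ a - ∑ a ∈ range k, ρ a ≤ τ k)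
    (hT2 : ∀ j₀ : ℕ, ∑ i ∈ range j₀, τ (i + 1) * τ (j₀ - i) / ((j₀ + 1 - i : ℕ) : ℝ) ≤ A₂ * τ (j₀ + 1))
    {K n : ℕ} {gA gB : ℕ → ℝ} (hA : RGEqH K β gA) (hB : RGEqH (K + n) β gB)
    (hAbox : ∀ k, k ≤ K → 0 < gA k ∧ gA k ≤ γ) (hBbox : ∀ k, k ≤ K + n → 0 < gB k ∧ gB k ≤ γ) (hpin : gA K = gB (K + n)) :
    ∀ j₀, j₀ ≤ K → (1 - W * γ / b) / (1 - 2 * W * γ / b) * A₂ ≤ b * Real.sqrt b * Real.sqrt ((K - j₀ : ℕ) : ℝ) →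
      1 / (gB (j₀ + n)) ^ 2 - 1 / (gA j₀) ^ 2
        ≤ 4 * ((1 - W * γ / b) / (1 - 2 * W * γ / b)) / Real.sqrt b * Real.sqrt ((K - j₀ : ℕ) : ℝ) * τ (j₀ + 1) := by
  have hx : W * γ / b < 1 / 2 := by rw [div_lt_iff₀ hb]; linarith
  have hc1 : 0 < 1 - W * γ / b := by linarith
  have hc2 : 0 < 1 - 2 * W * γ / b := by
    have : 2 * W * γ / b = 2 * (W * γ / b) := by ring
    rw [this]; linarith
  have hCw : 0 ≤ (1 - W * γ / b) / (1 - 2 * W * γ / b) := div_nonneg hc1.le hc2.le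
  exact disc_le_majorant_of_windowLaw hβ hb hγ hρ0 hτ0 hτmono hτ hT2 hCw hA hB hAbox hBbox hpin
    (fun j₀ hj₀ => window_law_upper_everywhere hβ hb hγ hρ0 hρW hsmall2 hA hB hAbox hBbox hpin hj₀)

/-- **ROAD P3 — THE MAJORANT AT EVERY POSITION ABOVE A CUTOFF THRESHOLD (smallness `Wγ < b`).**  Same two pinned runs with `Wγ < b`; the tail
majorant has bounded shifted sums `Σ_{i<N} τ(i+1) ≤ Ts`, and the short run is long enough: `2√2·Ts ≤ (1 − Wγ∕b)·b√b·K√K`.  THEN at EVERY position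
`j₀ ≤ K` with `2A₂ ≤ b√b·√(K−j₀)`: `1∕(g^B_{j₀+n})² − 1∕(g^A_{j₀})² ≤ (8∕√b)·√(K−j₀)·τ(j₀+1)` (the first file's `window_law_upper_everywhere_tail`, `C_w = 2`).
[cite: Balaban1987RG1, (0.20) p.256, (0.31) and Thm 2 p.259] -/
theorem disc_le_majorant_everywhere_tail
    (hβ : ∀ (k : ℕ) (p : Fin (k + 1) → ℝ),
      β k p = b + ∑ i : Fin (k + 1), ρ (k - i) * min (p (Fin.last k)) (|p (Fin.last k) - p i|))
    (hb : 0 < b) (hγ : 0 < γ) (hρ0 : ∀ a, 0 ≤ ρ a) (hρW : ∀ n, ∑ a ∈ range n, ρ a ≤ W) (hsmall : W * γ < b) {Ts : ℝ}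
    (hτ0 : ∀ k, 0 ≤ τ k) (hτmono : ∀ k l, k ≤ l → τ l ≤ τ k)
    (hτ : ∀ k N, k ≤ N → ∑ a ∈ range N, ρ a - ∑ a ∈ range k, ρ a ≤ τ k) (hTs : ∀ N, ∑ i ∈ range N, τ (i + 1) ≤ Ts)
    (hT2 : ∀ j₀ : ℕ, ∑ i ∈ range j₀, τ (i + 1) * τ (j₀ - i) / ((j₀ + 1 - i : ℕ) : ℝ) ≤ A₂ * τ (j₀ + 1))
    {K n : ℕ} (hKthr : 2 * Real.sqrt 2 * Ts ≤ (1 - W * γ / b) * (b * Real.sqrt b) * ((K : ℝ) * Real.sqrt (K : ℝ)))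
    {gA gB : ℕ → ℝ} (hA : RGEqH K β gA) (hB : RGEqH (K + n) β gB)
    (hAbox : ∀ k, k ≤ K → 0 < gA k ∧ gA k ≤ γ) (hBbox : ∀ k, k ≤ K + n → 0 < gB k ∧ gB k ≤ γ) (hpin : gA K = gB (K + n)) :
    ∀ j₀, j₀ ≤ K → 2 * A₂ ≤ b * Real.sqrt b * Real.sqrt ((K - j₀ : ℕ) : ℝ) →
      1 / (gB (j₀ + n)) ^ 2 - 1 / (gA j₀) ^ 2 ≤ 8 / Real.sqrt b * Real.sqrt ((K - j₀ : ℕ) : ℝ) * τ (j₀ + 1) := by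
  intro j₀ hj₀ hσ
  have h := disc_le_majorant_of_windowLaw (Cw := 2) hβ hb hγ hρ0 hτ0 hτmono hτ hT2 (by norm_num) hA hB hAbox hBbox hpin
    (fun j hj => window_law_upper_everywhere_tail hβ hb hγ hρ0 hρW hsmall hτ0 hτ hTs hKthr hA hB hAbox hBbox hpin hj) j₀ hj₀ hσ
  rw [show (4 : ℝ) * 2 = 8 by norm_num] at h
  exact h

/-! ## §3 A pinned family: the rate in the cutoff at every infrared distance, for every cutoff -/

/-- FAMILY FORM BETWEEN TWO CUTOFFS (`2Wγ < b`): for all infrared distances `m` with `C_wA₂ ≤ b√b·√m` and ALL cutoffs `n`, `n′`,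
`invSq g m (n + n′) − invSq g m n ≤ (4C_w∕√b)·√m·τ(n+1)` — §2 for the pair (run `n+m`, run `n+m+n′`) at the position `n`. [cite: Balaban1987RG1, Thm 2 p.259] -/
theorem invSq_sub_le_rate_everywhere
    (hβ : ∀ (k : ℕ) (p : Fin (k + 1) → ℝ),
      β k p = b + ∑ i : Fin (k + 1), ρ (k - i) * min (p (Fin.last k)) (|p (Fin.last k) - p i|))
    (hb : 0 < b) (hγ : 0 < γ) (hρ0 : ∀ a, 0 ≤ ρ a) (hρW : ∀ n, ∑ a ∈ range n, ρ a ≤ W) (hsmall2 : 2 * W * γ < b)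
    (hτ0 : ∀ k, 0 ≤ τ k) (hτmono : ∀ k l, k ≤ l → τ l ≤ τ k)
    (hτ : ∀ k N, k ≤ N → ∑ a ∈ range N, ρ a - ∑ a ∈ range k, ρ a ≤ τ k)
    (hT2 : ∀ j₀ : ℕ, ∑ i ∈ range j₀, τ (i + 1) * τ (j₀ - i) / ((j₀ + 1 - i : ℕ) : ℝ) ≤ A₂ * τ (j₀ + 1))
    {g : ℕ → ℕ → ℝ} {gIR : ℝ} (hrun : ∀ K, RGEqH K β (g K)) (hbox : ∀ K i, i ≤ K → 0 < g K i ∧ g K i ≤ γ)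
    (hpin : ∀ K, g K K = gIR) {m : ℕ} (hm : (1 - W * γ / b) / (1 - 2 * W * γ / b) * A₂ ≤ b * Real.sqrt b * Real.sqrt (m : ℝ))
    (n n' : ℕ) :
    invSq g m (n + n') - invSq g m n
      ≤ 4 * ((1 - W * γ / b) / (1 - 2 * W * γ / b)) / Real.sqrt b * Real.sqrt (m : ℝ) * τ (n + 1) := by
  have hpin' : g (n + m) (n + m) = g (n + m + n') (n + m + n') := by rw [hpin, hpin]
  have h := disc_le_majorant_everywhere hβ hb hγ hρ0 hρW hsmall2 hτ0 hτmono hτ hT2 (hrun (n + m)) (hrun (n + m + n'))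
    (hbox (n + m)) (hbox (n + m + n')) hpin' n (by omega) (by rw [show n + m - n = m by omega]; exact hm)
  rw [show n + m - n = m by omega] at h
  have e1 : invSq g m (n + n') = 1 / (g (n + m + n') (n + n')) ^ 2 := by
    rw [invSq_def, show n + n' + m = n + m + n' by omega]
  rw [e1, invSq_def]
  exact h

/-- **ROAD P3 — THE RATE OF THE CONTINUUM COUPLING IN THE CUTOFF, AT EVERY INFRARED DISTANCE AND FOR EVERY CUTOFF** (box-type smallness).  A
family `K ↦ g K` of runs of the order-0 profile family `β_{k+1} = b + Σ_{i≤k} ρ(k−i)·min(g_k, |g_k − g_i|)` in ]0,γ] pinned at one `g_IR` (`b > 0`,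
`γ > 0`, `ρ ≥ 0`, `Σ_{a<N} ρ_a ≤ W`, `2Wγ < b`), and a tail majorant `τ` of the memory profile (`Σ_{a∈[k,N)} ρ(a) ≤ τ(k)`, `τ ≥ 0` non-increasing) with
the ONE shape hypothesis (T2) `Σ_{i<j₀} τ(i+1)τ(j₀−i)∕(j₀+1−i) ≤ A₂τ(j₀+1)`.  THEN for every infrared distance `m` with `C_wA₂ ≤ b√b·√m`
(`C_w = (1−Wγ∕b)∕(1−2Wγ∕b)`) and EVERY cutoff `n`:  `0 ≤ astar g m − invSq g m n ≤ (4C_w∕√b)·√m·τ(n+1)`.  Generation 49's `…Rate.astar_sub_invSq_le_rate`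
needed (T1) and `m ≤ n + 1`; neither is needed. [cite: Balaban1987RG1, (0.20) p.256, (0.31) and Thm 2 p.259] -/
theorem astar_sub_invSq_le_rate_everywhere
    (hβ : ∀ (k : ℕ) (p : Fin (k + 1) → ℝ),
      β k p = b + ∑ i : Fin (k + 1), ρ (k - i) * min (p (Fin.last k)) (|p (Fin.last k) - p i|))
    (hb : 0 < b) (hγ : 0 < γ) (hρ0 : ∀ a, 0 ≤ ρ a) (hρW : ∀ n, ∑ a ∈ range n, ρ a ≤ W) (hsmall2 : 2 * W * γ < b)
    (hτ0 : ∀ k, 0 ≤ τ k) (hτmono : ∀ k l, k ≤ l → τ l ≤ τ k)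
    (hτ : ∀ k N, k ≤ N → ∑ a ∈ range N, ρ a - ∑ a ∈ range k, ρ a ≤ τ k)
    (hT2 : ∀ j₀ : ℕ, ∑ i ∈ range j₀, τ (i + 1) * τ (j₀ - i) / ((j₀ + 1 - i : ℕ) : ℝ) ≤ A₂ * τ (j₀ + 1))
    {g : ℕ → ℕ → ℝ} {gIR : ℝ} (hrun : ∀ K, RGEqH K β (g K)) (hbox : ∀ K i, i ≤ K → 0 < g K i ∧ g K i ≤ γ)
    (hpin : ∀ K, g K K = gIR) {m : ℕ} (hm : (1 - W * γ / b) / (1 - 2 * W * γ / b) * A₂ ≤ b * Real.sqrt b * Real.sqrt (m : ℝ))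
    (n : ℕ) :
    0 ≤ astar g m - invSq g m n ∧ astar g m - invSq g m n
      ≤ 4 * ((1 - W * γ / b) / (1 - 2 * W * γ / b)) / Real.sqrt b * Real.sqrt (m : ℝ) * τ (n + 1) := by
  have ht : Tendsto (invSq g m) atTop (𝓝 (astar g m)) := (continuum_monotone hβ hb hγ hρ0 hρW hrun hbox hpin).1 m
  have hmono := invSq_mono hβ hb hρ0 hrun hbox hpin m
  have h1 : invSq g m n ≤ astar g m := hmono.ge_of_tendsto ht n
  set C : ℝ := 4 * ((1 - W * γ / b) / (1 - 2 * W * γ / b)) / Real.sqrt b * Real.sqrt (m : ℝ) * τ (n + 1) with hC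
  have hev : ∀ᶠ k in atTop, invSq g m k ≤ invSq g m n + C := by
    refine Filter.eventually_atTop.mpr ⟨n, fun k hk => ?_⟩
    obtain ⟨n', rfl⟩ := Nat.exists_eq_add_of_le hk
    have := invSq_sub_le_rate_everywhere hβ hb hγ hρ0 hρW hsmall2 hτ0 hτmono hτ hT2 hrun hbox hpin hm n n'
    linarith
  have h2 : astar g m ≤ invSq g m n + C := le_of_tendsto ht hev
  constructor <;> linarith

/-- FAMILY FORM BETWEEN TWO CUTOFFS ABOVE THE CUTOFF THRESHOLD (`Wγ < b`): `2A₂ ≤ b√b·√m`, `2√2·Ts ≤ (1 − Wγ∕b)·b√b·m√m` ⇒ for ALL `n`, `n′`: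
`invSq g m (n + n′) − invSq g m n ≤ (8∕√b)·√m·τ(n+1)` (the short run has `n + m ≥ m` steps: its threshold follows). [cite: Balaban1987RG1, Thm 2 p.259] -/
theorem invSq_sub_le_rate_everywhere_tail
    (hβ : ∀ (k : ℕ) (p : Fin (k + 1) → ℝ),
      β k p = b + ∑ i : Fin (k + 1), ρ (k - i) * min (p (Fin.last k)) (|p (Fin.last k) - p i|))
    (hb : 0 < b) (hγ : 0 < γ) (hρ0 : ∀ a, 0 ≤ ρ a) (hρW : ∀ n, ∑ a ∈ range n, ρ a ≤ W) (hsmall : W * γ < b) {Ts : ℝ}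
    (hτ0 : ∀ k, 0 ≤ τ k) (hτmono : ∀ k l, k ≤ l → τ l ≤ τ k)
    (hτ : ∀ k N, k ≤ N → ∑ a ∈ range N, ρ a - ∑ a ∈ range k, ρ a ≤ τ k) (hTs : ∀ N, ∑ i ∈ range N, τ (i + 1) ≤ Ts)
    (hT2 : ∀ j₀ : ℕ, ∑ i ∈ range j₀, τ (i + 1) * τ (j₀ - i) / ((j₀ + 1 - i : ℕ) : ℝ) ≤ A₂ * τ (j₀ + 1))
    {g : ℕ → ℕ → ℝ} {gIR : ℝ} (hrun : ∀ K, RGEqH K β (g K)) (hbox : ∀ K i, i ≤ K → 0 < g K i ∧ g K i ≤ γ)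
    (hpin : ∀ K, g K K = gIR) {m : ℕ} (hm : 2 * A₂ ≤ b * Real.sqrt b * Real.sqrt (m : ℝ))
    (hmthr : 2 * Real.sqrt 2 * Ts ≤ (1 - W * γ / b) * (b * Real.sqrt b) * ((m : ℝ) * Real.sqrt (m : ℝ))) (n n' : ℕ) :
    invSq g m (n + n') - invSq g m n ≤ 8 / Real.sqrt b * Real.sqrt (m : ℝ) * τ (n + 1) := by
  have hc1 : 0 < 1 - W * γ / b := by
    have : W * γ / b < 1 := (div_lt_one hb).mpr hsmall
    linarith
  have hpin' : g (n + m) (n + m) = g (n + m + n') (n + m + n') := by rw [hpin, hpin]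
  -- the cutoff threshold on the short run `n + m` from the one on `m`
  have hKthr : 2 * Real.sqrt 2 * Ts
      ≤ (1 - W * γ / b) * (b * Real.sqrt b) * ((((n + m : ℕ) : ℝ)) * Real.sqrt (((n + m : ℕ) : ℝ))) := by
    refine hmthr.trans (mul_le_mul_of_nonneg_left ?_ (by positivity))
    have hle : (m : ℝ) ≤ ((n + m : ℕ) : ℝ) := by exact_mod_cast Nat.le_add_left m n
    exact mul_le_mul hle (Real.sqrt_le_sqrt hle) (Real.sqrt_nonneg _) (by positivity)
  have h := disc_le_majorant_everywhere_tail hβ hb hγ hρ0 hρW hsmall hτ0 hτmono hτ hTs hT2 hKthr (hrun (n + m)) (hrun (n + m + n'))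
    (hbox (n + m)) (hbox (n + m + n')) hpin' n (by omega) (by rw [show n + m - n = m by omega]; exact hm)
  rw [show n + m - n = m by omega] at h
  have e1 : invSq g m (n + n') = 1 / (g (n + m + n') (n + n')) ^ 2 := by
    rw [invSq_def, show n + n' + m = n + m + n' by omega]
  rw [e1, invSq_def]
  exact h

/-- **ROAD P3 — THE RATE IN THE CUTOFF AT EVERY INFRARED DISTANCE ABOVE THE THRESHOLDS, FOR EVERY CUTOFF** (generation 49's smallness
`Wγ < b`).  A pinned family of runs of the order-0 profile family in ]0,γ] (`b > 0`, `γ > 0`, `ρ ≥ 0`, `Σ_{a<N} ρ_a ≤ W`, `Wγ < b`); a tail majorant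
`τ ≥ 0`, non-increasing, `R(N) − R(k) ≤ τ(k)`, with bounded shifted sums `Σ_{i<N} τ(i+1) ≤ Ts` and the shape (T2) (constant `A₂`).  THEN for
every `m` with `2A₂ ≤ b√b·√m` and `2√2·Ts ≤ (1 − Wγ∕b)·b√b·m√m`, and EVERY cutoff `n`:  `0 ≤ astar g m − invSq g m n ≤ (8∕√b)·√m·τ(n+1)` — no (T1),
no `m ≤ n + 1`, and the constant `8∕√b` in place of `4∕√b + 8√2κA₁∕((1−Wγ∕b)√b)`. [cite: Balaban1987RG1, (0.20) p.256, (0.31) and Thm 2 p.259] -/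
theorem astar_sub_invSq_le_rate_everywhere_tail
    (hβ : ∀ (k : ℕ) (p : Fin (k + 1) → ℝ),
      β k p = b + ∑ i : Fin (k + 1), ρ (k - i) * min (p (Fin.last k)) (|p (Fin.last k) - p i|))
    (hb : 0 < b) (hγ : 0 < γ) (hρ0 : ∀ a, 0 ≤ ρ a) (hρW : ∀ n, ∑ a ∈ range n, ρ a ≤ W) (hsmall : W * γ < b) {Ts : ℝ}
    (hτ0 : ∀ k, 0 ≤ τ k) (hτmono : ∀ k l, k ≤ l → τ l ≤ τ k)
    (hτ : ∀ k N, k ≤ N → ∑ a ∈ range N, ρ a - ∑ a ∈ range k, ρ a ≤ τ k) (hTs : ∀ N, ∑ i ∈ range N, τ (i + 1) ≤ Ts)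
    (hT2 : ∀ j₀ : ℕ, ∑ i ∈ range j₀, τ (i + 1) * τ (j₀ - i) / ((j₀ + 1 - i : ℕ) : ℝ) ≤ A₂ * τ (j₀ + 1))
    {g : ℕ → ℕ → ℝ} {gIR : ℝ} (hrun : ∀ K, RGEqH K β (g K)) (hbox : ∀ K i, i ≤ K → 0 < g K i ∧ g K i ≤ γ)
    (hpin : ∀ K, g K K = gIR) {m : ℕ} (hm : 2 * A₂ ≤ b * Real.sqrt b * Real.sqrt (m : ℝ))
    (hmthr : 2 * Real.sqrt 2 * Ts ≤ (1 - W * γ / b) * (b * Real.sqrt b) * ((m : ℝ) * Real.sqrt (m : ℝ))) (n : ℕ) :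
    0 ≤ astar g m - invSq g m n ∧ astar g m - invSq g m n ≤ 8 / Real.sqrt b * Real.sqrt (m : ℝ) * τ (n + 1) := by
  have ht : Tendsto (invSq g m) atTop (𝓝 (astar g m)) := (continuum_monotone hβ hb hγ hρ0 hρW hrun hbox hpin).1 m
  have hmono := invSq_mono hβ hb hρ0 hrun hbox hpin m
  have h1 : invSq g m n ≤ astar g m := hmono.ge_of_tendsto ht n
  set C : ℝ := 8 / Real.sqrt b * Real.sqrt (m : ℝ) * τ (n + 1) with hC
  have hev : ∀ᶠ k in atTop, invSq g m k ≤ invSq g m n + C := by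
    refine Filter.eventually_atTop.mpr ⟨n, fun k hk => ?_⟩
    obtain ⟨n', rfl⟩ := Nat.exists_eq_add_of_le hk
    have := invSq_sub_le_rate_everywhere_tail hβ hb hγ hρ0 hρW hsmall hτ0 hτmono hτ hTs hT2 hrun hbox hpin hm hmthr n n'
    linarith
  have h2 : astar g m ≤ invSq g m n + C := le_of_tendsto ht hev
  constructor <;> linarith

/-! ## §4 Below the threshold distance, one constant (generation 50's comparison) -/

/-- **BELOW THE THRESHOLD DISTANCE (`2Wγ < b`).**  With a threshold distance `σ₀` (`C_wA₂ ≤ b√b·√σ₀`): for every `m ≤ σ₀` and every cutoff `n`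
with `σ₀ ≤ n + m` (the run `n + m` reaches the distance `σ₀`), `0 ≤ astar g m − invSq g m n ≤ (4C_w∕√b)·√σ₀·τ(n+m+1−σ₀)∕(1 − Wγ∕b)` — §3 at the
distance `σ₀` of the same run, carried to `m` by `…Comparison.astar_sub_invSq_comparison`.  Generation 50's `…RateUniform` needed `2σ₀ ≤ n + m + 1`.
[cite: Balaban1987RG1, (0.20) p.256, (0.31) and Thm 2 p.259] -/
theorem astar_sub_invSq_le_rate_everywhere_uniform
    (hβ : ∀ (k : ℕ) (p : Fin (k + 1) → ℝ),
      β k p = b + ∑ i : Fin (k + 1), ρ (k - i) * min (p (Fin.last k)) (|p (Fin.last k) - p i|))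
    (hb : 0 < b) (hγ : 0 < γ) (hρ0 : ∀ a, 0 ≤ ρ a) (hρW : ∀ n, ∑ a ∈ range n, ρ a ≤ W) (hsmall2 : 2 * W * γ < b)
    (hτ0 : ∀ k, 0 ≤ τ k) (hτmono : ∀ k l, k ≤ l → τ l ≤ τ k)
    (hτ : ∀ k N, k ≤ N → ∑ a ∈ range N, ρ a - ∑ a ∈ range k, ρ a ≤ τ k)
    (hT2 : ∀ j₀ : ℕ, ∑ i ∈ range j₀, τ (i + 1) * τ (j₀ - i) / ((j₀ + 1 - i : ℕ) : ℝ) ≤ A₂ * τ (j₀ + 1))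
    {g : ℕ → ℕ → ℝ} {gIR : ℝ} (hrun : ∀ K, RGEqH K β (g K)) (hbox : ∀ K i, i ≤ K → 0 < g K i ∧ g K i ≤ γ)
    (hpin : ∀ K, g K K = gIR) {σ₀ m n : ℕ}
    (hσ₀ : (1 - W * γ / b) / (1 - 2 * W * γ / b) * A₂ ≤ b * Real.sqrt b * Real.sqrt (σ₀ : ℝ)) (hm : m ≤ σ₀) (hn : σ₀ ≤ n + m) :
    0 ≤ astar g m - invSq g m n ∧ astar g m - invSq g m n
      ≤ 4 * ((1 - W * γ / b) / (1 - 2 * W * γ / b)) / Real.sqrt b * Real.sqrt (σ₀ : ℝ) * τ (n + m + 1 - σ₀) / (1 - W * γ / b) := by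
  have hW : 0 ≤ W := by simpa using hρW 0
  have hsmall : W * γ < b := by nlinarith
  have hc : 0 < 1 - W * γ / b := by
    have : W * γ / b < 1 := (div_lt_one hb).mpr hsmall
    linarith
  have hcmp := astar_sub_invSq_comparison hβ hb hγ hρ0 hρW hsmall hrun hbox hpin hm (n + m - σ₀)
  rw [show n + m - σ₀ + σ₀ - m = n by omega] at hcmp
  have hrate := astar_sub_invSq_le_rate_everywhere hβ hb hγ hρ0 hρW hsmall2 hτ0 hτmono hτ hT2 hrun hbox hpin hσ₀ (n + m - σ₀)
  rw [show n + m - σ₀ + 1 = n + m + 1 - σ₀ by omega] at hrate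
  exact ⟨hcmp.1, hcmp.2.trans (div_le_div_of_nonneg_right hrate.2 hc.le)⟩

/-- **BELOW THE THRESHOLD DISTANCE (`Wγ < b`, cutoff threshold).**  Thresholds at `σ₀`: `2A₂ ≤ b√b·√σ₀`, `2√2·Ts ≤ (1 − Wγ∕b)·b√b·σ₀√σ₀`; for
every `m ≤ σ₀` and `n` with `σ₀ ≤ n + m`: `0 ≤ astar g m − invSq g m n ≤ (8∕√b)·√σ₀·τ(n+m+1−σ₀)∕(1 − Wγ∕b)`.
[cite: Balaban1987RG1, (0.20) p.256, (0.31) and Thm 2 p.259] -/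
theorem astar_sub_invSq_le_rate_everywhere_uniform_tail
    (hβ : ∀ (k : ℕ) (p : Fin (k + 1) → ℝ),
      β k p = b + ∑ i : Fin (k + 1), ρ (k - i) * min (p (Fin.last k)) (|p (Fin.last k) - p i|))
    (hb : 0 < b) (hγ : 0 < γ) (hρ0 : ∀ a, 0 ≤ ρ a) (hρW : ∀ n, ∑ a ∈ range n, ρ a ≤ W) (hsmall : W * γ < b) {Ts : ℝ}
    (hτ0 : ∀ k, 0 ≤ τ k) (hτmono : ∀ k l, k ≤ l → τ l ≤ τ k)
    (hτ : ∀ k N, k ≤ N → ∑ a ∈ range N, ρ a - ∑ a ∈ range k, ρ a ≤ τ k) (hTs : ∀ N, ∑ i ∈ range N, τ (i + 1) ≤ Ts)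
    (hT2 : ∀ j₀ : ℕ, ∑ i ∈ range j₀, τ (i + 1) * τ (j₀ - i) / ((j₀ + 1 - i : ℕ) : ℝ) ≤ A₂ * τ (j₀ + 1))
    {g : ℕ → ℕ → ℝ} {gIR : ℝ} (hrun : ∀ K, RGEqH K β (g K)) (hbox : ∀ K i, i ≤ K → 0 < g K i ∧ g K i ≤ γ)
    (hpin : ∀ K, g K K = gIR) {σ₀ m n : ℕ} (hσ₀ : 2 * A₂ ≤ b * Real.sqrt b * Real.sqrt (σ₀ : ℝ))
    (hσthr : 2 * Real.sqrt 2 * Ts ≤ (1 - W * γ / b) * (b * Real.sqrt b) * ((σ₀ : ℝ) * Real.sqrt (σ₀ : ℝ)))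
    (hm : m ≤ σ₀) (hn : σ₀ ≤ n + m) :
    0 ≤ astar g m - invSq g m n ∧ astar g m - invSq g m n
      ≤ 8 / Real.sqrt b * Real.sqrt (σ₀ : ℝ) * τ (n + m + 1 - σ₀) / (1 - W * γ / b) := by
  have hc : 0 < 1 - W * γ / b := by
    have : W * γ / b < 1 := (div_lt_one hb).mpr hsmall
    linarith
  have hcmp := astar_sub_invSq_comparison hβ hb hγ hρ0 hρW hsmall hrun hbox hpin hm (n + m - σ₀)
  rw [show n + m - σ₀ + σ₀ - m = n by omega] at hcmp
  have hrate := astar_sub_invSq_le_rate_everywhere_tail hβ hb hγ hρ0 hρW hsmall hτ0 hτmono hτ hTs hT2 hrun hbox hpin hσ₀ hσthr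
    (n + m - σ₀)
  rw [show n + m - σ₀ + 1 = n + m + 1 - σ₀ by omega] at hrate
  exact ⟨hcmp.1, hcmp.2.trans (div_le_div_of_nonneg_right hrate.2 hc.le)⟩

end Summit.QuantumFields.BalabanUV.Beta.RemainderExplicitHistoryDiagonalRateEverywhere

end
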